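import Mathlib.Analysis.SpecialFunctions.ExpDeriv
import Mathlib.Analysis.SpecialFunctions.Log.Deriv
import Mathlib.LinearAlgebra.Matrix.SchurComplement
import Literature.NumberTheory.Transcendental.KZSemiCanonicalReductionProofs
import Literature.NumberTheory.Transcendental.DownSetTailDecay
import HarnessLib

/-!
# Monomial compression of finite-volume semialgebraic down-sets (proof file)

Third proof file around the named fact `KZ.semiCanonicalReduction` [Viu-Sos 2021, Thm. 1.1]
(`KZVolumeConjecture.lean`; steps (a), (c), (d) of the printed proof are in
`KZSemiCanonicalReductionProofs.lean`). The printed step (b) — *separation of poles* by Hironaka's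
embedded resolution of singularities [Viu-Sos 2021, Prop. 2.2 / Cor. 2.2] — is replaced in the tree
by a resolution-free argument whose second half is this file:

**Theorem** (`KZ.exists_isBounded_of_downset`). Let `D ⊆ (0, ∞)^{m+1}` be a `ℚ`-semialgebraic
coordinatewise down-set (`x ∈ D`, `0 < yᵢ ≤ xᵢ` `⇒ y ∈ D`) of finite volume. Then the
representation `∫_D 1` differs by KZ relations from `∫_B 1` for a BOUNDED `ℚ`-semialgebraic
`B ⊆ ℝ^{m+1}`.

*Proof.* By the polynomial box decay of finite-volume down-sets
(`DownSetTail.exists_prod_le_mul_rpow`, an elementary consequence of Tarski–Seidenberg proved in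
`DownSetTailDecay.lean`): `∏ xᵢ ≤ C (max xᵢ)^{-α}` on `D ∩ {max xᵢ ≥ 1}` for some `C, α > 0`.
Choose an integer `q ≥ (m+1)/α + 1`, put `η = 1/q`, `β = (q-1)/(q(m+1))` (so `η + (m+1)β = 1`
and `η ≤ αβ`) and consider the *monomial compression*
`Φ(x)ⱼ = xⱼ^η · (∏ᵢ xᵢ)^β = exp(η log xⱼ + β ∑ᵢ log xᵢ)` on the open orthant. In logarithmic
coordinates it is the linear map `η·I + β·J` (`J` the all-ones matrix), so it is injective; its
Jacobian matrix is `diag(Φ(x)) (ηI + βJ) diag(x)⁻¹`, of CONSTANT determinant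
`det(ηI + βJ) = η^m (η + (m+1)β) = η^m` (matrix determinant lemma); it is `ℚ`-semialgebraic
(`Φⱼ^{q(m+1)} = xⱼ^{m+1} (∏ xᵢ)^{q-1}`); and on `D` every `Φ(x)ⱼ ≤ max(1, C^β)`: for
`max xᵢ ≤ 1` because all exponents are non-negative and sum to `1`, for `max xᵢ ≥ 1` because
`log Φⱼ ≤ η log max + β (log C − α log max) ≤ β log C`. Hence one change-of-variables move
(rule (2)) gives `[D, 1] ≡ [Φ(D), q^m]` with `Φ(D)` bounded, and the linear substitution
`diag(q^m, 1, …, 1)` (rule (2) again) gives `[Φ(D), q^m] ≡ [B, 1]`.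

The first half of the replacement of step (b) — every finite-volume `ℚ`-semialgebraic set is
KZ-equivalent to such a down-set, by grounding the coordinates one after the other
(`SemialgebraicGrounding.lean`) inside the calculus — is the business of a companion proof file
(grounding as relations); this file does not depend on it.

## Main statements (all proved; no definition, no named fact)

* `KZ.det_of_diag_add_const` — `det(ηI + βJ) = η^m (η + (m+1)β)` on `Fin (m+1)`;
* `KZ.hasFDerivAt_monomialCompression`, `KZ.det_fderiv_monomialCompression`,
  `KZ.injOn_monomialCompression`, `KZ.isSemialgebraicMapOn_monomialCompression`,
  `KZ.monomialCompression_le` — the four properties of `Φ` listed above;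
* `KZ.of_sub_of_mem_changeOfVariablesRel_linear` — a linear substitution is a move;
* `KZ.exists_isBounded_of_downset` — the theorem.

## References

* J. Viu-Sos, *A semi-canonical reduction for periods of Kontsevich–Zagier*, Int. J. Number
  Theory 17 (2021) 147–174 (arXiv:1509.01097), Thm. 1.1, Prop. 2.2, Cor. 2.2 (the step replaced).
* M. Kontsevich, D. Zagier, *Periods* (2001), §1.2 (rule (2), change of variables).
* M. Yoshinaga, *Periods and elementary real numbers*, arXiv:0805.0349 (2008), §3 (bounded
  reduction of finite-volume semialgebraic sets, there via rectilinearization).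
-/

noncomputable section

open MeasureTheory Set MvPolynomial Filter Topology
open scoped ENNReal
open Literature.ModelTheory.ExponentialFields

namespace Literature.NumberTheory.Transcendental

namespace KZ

variable {m : ℕ}

/-! ### The determinant of `ηI + βJ` -/

/-- **Matrix determinant lemma for `ηI + βJ`.** On `Fin (m + 1)`,
`det (η δᵢⱼ + β)ᵢⱼ = η^m (η + (m + 1) β)` for `η ≠ 0`
(`ηI + βJ = η (I + (β/η) 𝟙 𝟙ᵀ)` and `det(I + u vᵀ) = 1 + v ⬝ u`). [folklore] -/
theorem det_of_diag_add_const (η β : ℝ) (hη : η ≠ 0) :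
    (Matrix.of fun i j : Fin (m + 1) => (if i = j then η else 0) + β).det =
      η ^ m * (η + (m + 1) * β) := by
  have hM : (Matrix.of fun i j : Fin (m + 1) => (if i = j then η else 0) + β) =
      η • ((1 : Matrix (Fin (m + 1)) (Fin (m + 1)) ℝ) +
        Matrix.replicateCol (Fin 1) (fun _ => β / η) * Matrix.replicateRow (Fin 1) fun _ => (1 : ℝ)) := by
    ext i j
    simp only [Matrix.of_apply, Matrix.smul_apply, Matrix.add_apply, Matrix.one_apply,
      Matrix.mul_apply, Matrix.replicateCol_apply, Matrix.replicateRow_apply, smul_eq_mul,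
      Finset.univ_unique, Finset.sum_singleton, mul_one]
    split_ifs
    · field_simp
    · field_simp
      ring
  have hdet : ((1 : Matrix (Fin (m + 1)) (Fin (m + 1)) ℝ) +
      Matrix.replicateCol (Fin 1) (fun _ => β / η) * Matrix.replicateRow (Fin 1) fun _ => (1 : ℝ)).det =
      1 + (fun _ => (1 : ℝ)) ⬝ᵥ (fun _ : Fin (m + 1) => β / η) := by
    convert Matrix.det_one_add_replicateCol_mul_replicateRow (ι := Fin 1)
      (fun _ : Fin (m + 1) => β / η) fun _ => (1 : ℝ) using 3
    ext i j
    simp [Matrix.mul_apply]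
  rw [hM, Matrix.det_smul, Fintype.card_fin, hdet]
  simp only [dotProduct, one_mul, Finset.sum_const, Finset.card_univ, Fintype.card_fin,
    nsmul_eq_mul, Nat.cast_add, Nat.cast_one]
  rw [pow_succ]
  field_simp

/-! ### The monomial compression map

Throughout, the map is written out: `Φ x j = exp (η * log (x j) + β * ∑ i, log (x i))`, which on
the open positive orthant is `(x j)^η (∏ i, x i)^β`. -/

/-- The sum of the exponents of the compression over the coordinates: with `η + (m+1) β = 1`,
`∑ⱼ (η log xⱼ + β ∑ᵢ log xᵢ) = ∑ᵢ log xᵢ`. [folklore] -/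
theorem sum_exponent_monomialCompression (η β : ℝ) (hηβ : η + (m + 1) * β = 1)
    (x : Fin (m + 1) → ℝ) :
    ∑ j, (η * Real.log (x j) + β * ∑ i, Real.log (x i)) = ∑ i, Real.log (x i) := by
  rw [Finset.sum_add_distrib, ← Finset.mul_sum, Finset.sum_const, Finset.card_univ,
    Fintype.card_fin, nsmul_eq_mul]
  have : η * ∑ i, Real.log (x i) + (↑(m + 1) : ℝ) * (β * ∑ i, Real.log (x i)) =
      (η + (m + 1) * β) * ∑ i, Real.log (x i) := by push_cast; ring
  rw [this, hηβ, one_mul]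

/-- The product of the coordinates of the compression is the product of the coordinates:
`∏ⱼ Φ(x)ⱼ = ∏ᵢ xᵢ` on the open orthant (when `η + (m+1) β = 1`). [folklore] -/
theorem prod_monomialCompression (η β : ℝ) (hηβ : η + (m + 1) * β = 1)
    {x : Fin (m + 1) → ℝ} (hx : ∀ i, 0 < x i) :
    ∏ j, Real.exp (η * Real.log (x j) + β * ∑ i, Real.log (x i)) = ∏ i, x i := by
  rw [← Real.exp_sum, sum_exponent_monomialCompression η β hηβ, Real.exp_sum]
  exact Finset.prod_congr rfl fun i _ => Real.exp_log (hx i)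

/-- **Injectivity.** The compression is injective on the open positive orthant (when `η ≠ 0` and
`η + (m+1) β = 1`): in logarithmic coordinates it is the invertible linear map `ηI + βJ`.
[folklore] -/
theorem injOn_monomialCompression (η β : ℝ) (hη : η ≠ 0) (hηβ : η + (m + 1) * β = 1) :
    InjOn (fun (x : Fin (m + 1) → ℝ) (j : Fin (m + 1)) =>
      Real.exp (η * Real.log (x j) + β * ∑ i, Real.log (x i))) {x | ∀ i, 0 < x i} := by
  intro x hx y hy hxy
  have hj : ∀ j, η * Real.log (x j) + β * ∑ i, Real.log (x i) =
      η * Real.log (y j) + β * ∑ i, Real.log (y i) := fun j =>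
    Real.exp_injective (congr_fun hxy j)
  have hsum : ∑ i, Real.log (x i) = ∑ i, Real.log (y i) := by
    rw [← sum_exponent_monomialCompression η β hηβ x, ← sum_exponent_monomialCompression η β hηβ y]
    exact Finset.sum_congr rfl fun j _ => hj j
  funext j
  have h := hj j
  rw [hsum, add_left_inj] at h
  have h' : Real.log (x j) = Real.log (y j) := mul_left_cancel₀ hη h
  exact Real.log_injOn_pos (hx j) (hy j) h'

/-- **Derivative.** On the open orthant the compression is differentiable, with derivative
`h ↦ (Φ(x)ⱼ (η hⱼ/xⱼ + β ∑ᵢ hᵢ/xᵢ))ⱼ`. [folklore] -/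
theorem hasFDerivAt_monomialCompression (η β : ℝ) {x : Fin (m + 1) → ℝ} (hx : ∀ i, 0 < x i) :
    HasFDerivAt (fun (x : Fin (m + 1) → ℝ) (j : Fin (m + 1)) =>
        Real.exp (η * Real.log (x j) + β * ∑ i, Real.log (x i)))
      (ContinuousLinearMap.pi fun j : Fin (m + 1) =>
        Real.exp (η * Real.log (x j) + β * ∑ i, Real.log (x i)) •
          (η • ((x j)⁻¹ • ContinuousLinearMap.proj (R := ℝ) (φ := fun _ : Fin (m + 1) => ℝ) j) +
            β • ∑ i, (x i)⁻¹ • ContinuousLinearMap.proj (R := ℝ) (φ := fun _ : Fin (m + 1) => ℝ) i))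
      x := by
  rw [hasFDerivAt_pi]
  intro j
  have hlog : ∀ i : Fin (m + 1), HasFDerivAt (fun y : Fin (m + 1) → ℝ => Real.log (y i))
      ((x i)⁻¹ • ContinuousLinearMap.proj (R := ℝ) (φ := fun _ : Fin (m + 1) => ℝ) i) x :=
    fun i => (hasFDerivAt_apply i x).log (hx i).ne'
  have hsum : HasFDerivAt (fun y : Fin (m + 1) → ℝ => ∑ i, Real.log (y i))
      (∑ i, (x i)⁻¹ • ContinuousLinearMap.proj (R := ℝ) (φ := fun _ : Fin (m + 1) => ℝ) i) x :=
    HasFDerivAt.fun_sum fun i _ => hlog i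
  exact (((hlog j).const_mul η).add (hsum.const_mul β)).exp

/-- **The Jacobian determinant is constant**: the derivative of the compression at a point of the
open orthant has determinant `η^m (η + (m+1) β)` — its matrix is
`diag(Φ(x)) (ηI + βJ) diag(x)⁻¹` and `∏ⱼ Φ(x)ⱼ = ∏ᵢ xᵢ`. [folklore] -/
theorem det_fderiv_monomialCompression (η β : ℝ) (hη : η ≠ 0) (hηβ : η + (m + 1) * β = 1)
    {x : Fin (m + 1) → ℝ} (hx : ∀ i, 0 < x i) :
    (ContinuousLinearMap.pi fun j : Fin (m + 1) =>
        Real.exp (η * Real.log (x j) + β * ∑ i, Real.log (x i)) •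
          (η • ((x j)⁻¹ • ContinuousLinearMap.proj (R := ℝ) (φ := fun _ : Fin (m + 1) => ℝ) j) +
            β • ∑ i, (x i)⁻¹ • ContinuousLinearMap.proj (R := ℝ) (φ := fun _ : Fin (m + 1) => ℝ) i)).det =
      η ^ m := by
  set E : Fin (m + 1) → ℝ := fun j => Real.exp (η * Real.log (x j) + β * ∑ i, Real.log (x i))
    with hE
  set L := (ContinuousLinearMap.pi fun j : Fin (m + 1) =>
        E j • (η • ((x j)⁻¹ • ContinuousLinearMap.proj (R := ℝ) (φ := fun _ : Fin (m + 1) => ℝ) j) +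
            β • ∑ i, (x i)⁻¹ • ContinuousLinearMap.proj (R := ℝ) (φ := fun _ : Fin (m + 1) => ℝ) i))
    with hL
  show L.det = η ^ m
  have happly : ∀ i j, L (Pi.single j 1) i =
      E i * (η * ((x i)⁻¹ * if i = j then 1 else 0) + β * (x j)⁻¹) := by
    intro i j
    simp only [hL, ContinuousLinearMap.pi_apply, FunLike.coe_smul,
      FunLike.coe_add, FunLike.coe_sum, Pi.smul_apply, Pi.add_apply,
      Finset.sum_apply, ContinuousLinearMap.proj_apply, Pi.single_apply, smul_eq_mul, mul_ite,
      mul_one, mul_zero, Finset.sum_ite_eq', Finset.mem_univ, if_true]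
  have hmat : LinearMap.toMatrix' (L : (Fin (m + 1) → ℝ) →ₗ[ℝ] (Fin (m + 1) → ℝ)) =
      Matrix.diagonal E * ((Matrix.of fun i j : Fin (m + 1) => (if i = j then η else 0) + β) *
        Matrix.diagonal fun i => (x i)⁻¹) := by
    ext i j
    rw [LinearMap.toMatrix'_apply, Matrix.diagonal_mul, Matrix.mul_diagonal, Matrix.of_apply,
      ContinuousLinearMap.coe_coe, happly]
    by_cases hij : i = j
    · subst hij
      simp only [if_true]
      ring
    · simp only [if_neg hij]
      ring
  rw [ContinuousLinearMap.det, ← LinearMap.det_toMatrix', hmat, Matrix.det_mul, Matrix.det_mul,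
    Matrix.det_diagonal, Matrix.det_diagonal, det_of_diag_add_const η β hη, hηβ, mul_one]
  have hP : ∏ i, E i = ∏ i, x i := prod_monomialCompression η β hηβ hx
  rw [hP, Finset.prod_inv_distrib]
  have hP0 : ∏ i, x i ≠ 0 := Finset.prod_ne_zero_iff.mpr fun i _ => (hx i).ne'
  field_simp


/-- **Semialgebraicity.** With `η = 1/q` and `β = (q-1)/(q(m+1))` for an integer `q ≥ 1`, the
compression is a `ℚ`-semialgebraic map on every `ℚ`-semialgebraic subset of the open orthant:
its `j`-th coordinate `y` is characterised there by `y > 0` and the polynomial identity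
`y^{q(m+1)} = xⱼ^{m+1} (∏ᵢ xᵢ)^{q-1}`. [folklore] -/
theorem isSemialgebraicMapOn_monomialCompression (q : ℕ) (hq : 1 ≤ q) (η β : ℝ)
    (hη : η = 1 / q) (hβ : β = (q - 1) / (q * (m + 1))) {s : Set (Fin (m + 1) → ℝ)}
    (hs : IsSemialgebraic ℚ s) (hpos : ∀ x ∈ s, ∀ i, 0 < x i) :
    IsSemialgebraicMapOn ℚ s (fun (x : Fin (m + 1) → ℝ) (j : Fin (m + 1)) =>
      Real.exp (η * Real.log (x j) + β * ∑ i, Real.log (x i))) := by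
  have hq0 : (q : ℝ) ≠ 0 := by exact_mod_cast (Nat.one_le_iff_ne_zero.mp hq)
  -- the power identity
  have hpow : ∀ x : Fin (m + 1) → ℝ, (∀ i, 0 < x i) → ∀ j,
      Real.exp (η * Real.log (x j) + β * ∑ i, Real.log (x i)) ^ (q * (m + 1)) =
        x j ^ (m + 1) * (∏ i, x i) ^ (q - 1) := by
    intro x hx j
    rw [← Real.exp_nat_mul]
    have h1 : ((q * (m + 1) : ℕ) : ℝ) * (η * Real.log (x j) + β * ∑ i, Real.log (x i)) =
        ((m + 1 : ℕ) : ℝ) * Real.log (x j) + ((q - 1 : ℕ) : ℝ) * ∑ i, Real.log (x i) := by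
      rw [hη, hβ, Nat.cast_sub hq]
      push_cast
      field_simp
    rw [h1, Real.exp_add, Real.exp_nat_mul, Real.exp_nat_mul, Real.exp_log (hx j), Real.exp_sum,
      Finset.prod_congr rfl fun i _ => Real.exp_log (hx i)]
  refine IsSemialgebraicMapOn.of_forall hs fun j => ?_
  rw [isSemialgebraicFunOn_iff]
  -- the describing polynomial
  set P : MvPolynomial (Fin (m + 1 + 1)) ℚ :=
    X (Fin.last (m + 1)) ^ (q * (m + 1)) -
      X (Fin.castSucc j) ^ (m + 1) * (∏ i : Fin (m + 1), X (Fin.castSucc i)) ^ (q - 1) with hP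
  have hPeval : ∀ z : Fin (m + 1 + 1) → ℝ, aeval z P =
      z (Fin.last (m + 1)) ^ (q * (m + 1)) -
        z (Fin.castSucc j) ^ (m + 1) * (∏ i : Fin (m + 1), z (Fin.castSucc i)) ^ (q - 1) := by
    intro z
    simp only [hP, map_sub, map_mul, map_pow, map_prod, aeval_X]
  have hset : {z : Fin (m + 1 + 1) → ℝ | (Fin.init z : Fin (m + 1) → ℝ) ∈ s ∧
      z (Fin.last (m + 1)) = Real.exp (η * Real.log ((Fin.init z : Fin (m + 1) → ℝ) j) +
        β * ∑ i, Real.log ((Fin.init z : Fin (m + 1) → ℝ) i))} =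
      {z : Fin (m + 1 + 1) → ℝ | (Fin.init z : Fin (m + 1) → ℝ) ∈ s} ∩
        ({z | 0 < aeval z (X (Fin.last (m + 1)) : MvPolynomial _ ℚ)} ∩ {z | aeval z P = 0}) := by
    ext z
    simp only [mem_setOf_eq, mem_inter_iff, aeval_X, hPeval, sub_eq_zero]
    constructor
    · rintro ⟨hzs, hz⟩
      refine ⟨hzs, ?_, ?_⟩
      · rw [hz]; exact Real.exp_pos _
      · rw [hz, hpow _ (hpos _ hzs) j]
        rfl
    · rintro ⟨hzs, hzpos, hzeq⟩
      refine ⟨hzs, ?_⟩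
      have hq' : q * (m + 1) ≠ 0 := Nat.mul_ne_zero (Nat.one_le_iff_ne_zero.mp hq) (Nat.succ_ne_zero m)
      rw [← pow_left_inj₀ hzpos.le (Real.exp_pos _).le hq', hzeq, hpow _ (hpos _ hzs) j]
      rfl
  rw [hset]
  exact hs.setOf_init_mem.inter ((isSemialgebraic_setOf_eval_pos _).inter
    (isSemialgebraic_setOf_eval_eq_zero P))

/-- **Boundedness on a down-set with polynomial box decay.** If `η, β ≥ 0`, `η ≤ αβ`, and `∏ xᵢ ≤ C (max xᵢ)^{-α}` whenever `max xᵢ ≥ 1`, then every coordinate of the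
compression of a point `x` of the open orthant is at most `max 1 (exp (β log C))`. [folklore] -/
theorem monomialCompression_le (η β α C : ℝ) (hη : 0 ≤ η) (hβ : 0 ≤ β)
    (hαβ : η ≤ α * β) (hC : 0 < C) {x : Fin (m + 1) → ℝ} (hx : ∀ i, 0 < x i)
    (hdecay : 1 ≤ DownSetTail.msup x → ∏ i, x i ≤ C * DownSetTail.msup x ^ (-α)) (j : Fin (m + 1)) :
    Real.exp (η * Real.log (x j) + β * ∑ i, Real.log (x i)) ≤ max 1 (Real.exp (β * Real.log C)) := by
  set μ := DownSetTail.msup x with hμ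
  have hμpos : 0 < μ := by
    obtain ⟨i, hi⟩ := DownSetTail.exists_msup_eq x
    rw [hμ, hi]; exact hx i
  have hlogj : Real.log (x j) ≤ Real.log μ := Real.log_le_log (hx j) (DownSetTail.le_msup x j)
  rcases le_total μ 1 with hμ1 | hμ1
  · -- all coordinates are `≤ 1`
    refine le_trans ?_ (le_max_left _ _)
    rw [← Real.exp_zero, Real.exp_le_exp]
    have hlog0 : ∀ i, Real.log (x i) ≤ 0 := fun i =>
      Real.log_nonpos (hx i).le ((DownSetTail.le_msup x i).trans hμ1)
    have hsum : ∑ i, Real.log (x i) ≤ 0 := Finset.sum_nonpos fun i _ => hlog0 i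
    nlinarith [hlog0 j, mul_nonpos_iff.mpr (Or.inl ⟨hβ, hsum⟩), mul_nonpos_iff.mpr (Or.inl ⟨hη, hlog0 j⟩)]
  · -- the decay regime
    refine le_trans ?_ (le_max_right _ _)
    rw [Real.exp_le_exp]
    have hprod : ∑ i, Real.log (x i) = Real.log (∏ i, x i) :=
      (Real.log_prod fun i _ => (hx i).ne').symm
    have hP : 0 < ∏ i, x i := Finset.prod_pos fun i _ => hx i
    have hlogP : Real.log (∏ i, x i) ≤ Real.log C - α * Real.log μ := by
      have h := Real.log_le_log hP (hdecay hμ1)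
      rw [Real.log_mul hC.ne' (Real.rpow_pos_of_pos hμpos _).ne', Real.log_rpow hμpos] at h
      linarith
    have hlogμ : 0 ≤ Real.log μ := Real.log_nonneg hμ1
    rw [hprod]
    nlinarith [mul_le_mul_of_nonneg_left hlogj hη, mul_le_mul_of_nonneg_left hlogP hβ,
      mul_le_mul_of_nonneg_right hαβ hlogμ]

/-! ### Linear substitutions are moves -/

variable {n : ℕ} in
/-- **A linear substitution is a change-of-variables move** (rule (2) with `Φ` a continuous
linear map, which is its own derivative): if `L` is `ℚ`-semialgebraic and injective on `σ`,
`r'.domain = L(σ)` and `f = (f' ∘ L) · |det L|` on `σ`, then `[r] − [r'] ∈ changeOfVariablesRel`.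
[Kontsevich–Zagier 2001, §1.2, rule (2)] [cite: KontsevichZagier2001, §1.2 rule (2)] -/
theorem of_sub_of_mem_changeOfVariablesRel_linear (r r' : IntegralRep n)
    (L : (Fin n → ℝ) →L[ℝ] (Fin n → ℝ)) (hL : IsSemialgebraicMapOn ℚ r.domain L)
    (hinj : InjOn L r.domain) (hd : r'.domain = L '' r.domain)
    (hi : ∀ x ∈ r.domain, r.integrand x = r'.integrand (L x) * |L.det|) :
    of r - of r' ∈ changeOfVariablesRel :=
  ⟨n, r, r', L, fun _ => L, hL, fun _ _ => L.hasFDerivWithinAt, hinj, hd, hi, rfl⟩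

/-! ### The compression theorem -/

/-- **Finite-volume down-sets are KZ-equivalent to bounded sets.** Let `D` be a representation
in dimension `m + 1` with integrand `1` whose domain is a coordinatewise down-set of the open
positive orthant (necessarily `ℚ`-semialgebraic and of finite volume). Then `[D] − [B] ∈ relations`
for a representation `B` with integrand `1` on a BOUNDED domain: one change of variables by the
monomial compression `Φ(x)ⱼ = xⱼ^η (∏ xᵢ)^β` (`η = 1/q`, `β = (q−1)/(q(m+1))`, `q` large in terms
of the decay exponent of `DownSetTail.exists_prod_le_mul_rpow`), whose Jacobian determinant is the
constant `q^{−m}` and whose image of `D` is bounded, followed by the linear substitution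
`diag(q^m, 1, …, 1)`. This is the tree's resolution-free substitute for the separation of poles
[Viu-Sos 2021, Prop. 2.2 / Cor. 2.2] in the proof of [Viu-Sos 2021, Thm. 1.1].
[cite: ViuSos2021, Thm. 1.1 (step Cor. 2.2, replaced)] -/
theorem exists_isBounded_of_downset (D : IntegralRep (m + 1))
    (hpos : ∀ x ∈ D.domain, ∀ i, 0 < x i)
    (hdown : ∀ x ∈ D.domain, ∀ y : Fin (m + 1) → ℝ, (∀ i, 0 < y i ∧ y i ≤ x i) → y ∈ D.domain)
    (h1 : ∀ x ∈ D.domain, D.integrand x = 1) :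
    ∃ B : IntegralRep (m + 1), Bornology.IsBounded B.domain ∧ (∀ x ∈ B.domain, B.integrand x = 1) ∧
      of D - of B ∈ relations := by
  classical
  -- finite volume
  have hmeas : MeasurableSet D.domain := IntegralRep.measurableSet_domain_holds D
  have hfin : volume D.domain ≠ ⊤ := by
    have hint : IntegrableOn (fun _ => (1 : ℝ)) D.domain :=
      D.integrableOn.congr_fun (fun x hx => h1 x hx) hmeas
    have h2 := hint.2
    unfold HasFiniteIntegral at h2
    rw [lintegral_const, Measure.restrict_apply_univ, enorm_one, one_mul] at h2
    exact h2.ne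
  -- polynomial box decay
  obtain ⟨C, α, hC, hα, hdecay⟩ :=
    DownSetTail.exists_prod_le_mul_rpow D.isSemialgebraic_domain hpos hdown hfin
  -- the exponents
  set q : ℕ := ⌈(m + 1 : ℝ) / α⌉₊ + 2 with hq
  have hq1 : 1 ≤ q := by omega
  have hqR : (q : ℝ) = ⌈(m + 1 : ℝ) / α⌉₊ + 2 := by rw [hq]; push_cast; ring
  have hq0 : (0 : ℝ) < q := by rw [hqR]; positivity
  have hqα : (m + 1 : ℝ) ≤ α * (q - 1) := by
    have h1 : (m + 1 : ℝ) / α ≤ ⌈(m + 1 : ℝ) / α⌉₊ := Nat.le_ceil _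
    have h2 : (m + 1 : ℝ) = α * ((m + 1 : ℝ) / α) := by field_simp
    rw [h2, hqR]
    exact mul_le_mul_of_nonneg_left (by linarith) hα.le
  set η : ℝ := 1 / q with hη
  set β : ℝ := (q - 1) / (q * (m + 1)) with hβ
  have hηpos : 0 < η := by rw [hη]; positivity
  have hβpos : 0 ≤ β := by
    rw [hβ]
    apply div_nonneg
    · have : (1 : ℝ) ≤ q := by exact_mod_cast hq1
      linarith
    · positivity
  have hηβ : η + (m + 1) * β = 1 := by
    rw [hη, hβ]
    field_simp
    ring
  have hαβ : η ≤ α * β := by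
    rw [hη, hβ, div_le_iff₀ hq0]
    have : α * ((↑q - 1) / (↑q * (↑m + 1))) * ↑q = α * (q - 1) / (m + 1) := by
      field_simp
    rw [this, le_div_iff₀ (by positivity)]
    linarith
  -- the compression and its image
  have hsa := isSemialgebraicMapOn_monomialCompression q hq1 η β hη hβ D.isSemialgebraic_domain hpos
  set Φ : (Fin (m + 1) → ℝ) → (Fin (m + 1) → ℝ) := fun x j =>
    Real.exp (η * Real.log (x j) + β * ∑ i, Real.log (x i)) with hΦ
  set M : ℝ := max 1 (Real.exp (β * Real.log C)) with hM
  have hbox : Φ '' D.domain ⊆ Icc (fun _ => 0) (fun _ => M) := by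
    rintro _ ⟨x, hx, rfl⟩
    exact ⟨fun j => (Real.exp_pos _).le, fun j =>
      monomialCompression_le η β α C hηpos.le hβpos hαβ hC (hpos x hx) (hdecay x hx) j⟩
  have hTb : Bornology.IsBounded (Φ '' D.domain) := (Metric.isBounded_Icc _ _).subset hbox
  have hT : IsSemialgebraic ℚ (Φ '' D.domain) :=
    IsSemialgebraicMapOn.isSemialgebraic_image_holds hsa subset_rfl D.isSemialgebraic_domain
  have hTfin : volume (Φ '' D.domain) ≠ ⊤ := hTb.measure_lt_top.ne
  -- the intermediate representation `[Φ(D), q^m]`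
  have hconst : IsSemialgebraicFunOn ℚ (Φ '' D.domain) fun _ => ((q : ℝ)) ^ m := by
    simpa using isSemialgebraicFunOn_ratCast hT ((q : ℚ) ^ m)
  let R : IntegralRep (m + 1) := ⟨Φ '' D.domain, fun _ => (q : ℝ) ^ m, hT, hconst,
    integrableOn_const hTfin⟩
  have hdet : ∀ x ∈ D.domain, |(ContinuousLinearMap.pi fun j : Fin (m + 1) =>
      Real.exp (η * Real.log (x j) + β * ∑ i, Real.log (x i)) •
        (η • ((x j)⁻¹ • ContinuousLinearMap.proj (R := ℝ) (φ := fun _ : Fin (m + 1) => ℝ) j) +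
          β • ∑ i, (x i)⁻¹ • ContinuousLinearMap.proj (R := ℝ) (φ := fun _ : Fin (m + 1) => ℝ) i)).det| =
      η ^ m := fun x hx => by
    rw [det_fderiv_monomialCompression η β hηpos.ne' hηβ (hpos x hx), abs_of_pos (pow_pos hηpos m)]
  have e1 : of D - of R ∈ changeOfVariablesRel := by
    refine ⟨m + 1, D, R, Φ, _, hsa, fun x hx =>
      (hasFDerivAt_monomialCompression η β (hpos x hx)).hasFDerivWithinAt,
      (injOn_monomialCompression η β hηpos.ne' hηβ).mono fun x hx => hpos x hx, rfl,
      fun x hx => ?_, rfl⟩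
    rw [hdet x hx, h1 x hx]
    show (1 : ℝ) = (q : ℝ) ^ m * η ^ m
    rw [hη, ← mul_pow, mul_one_div_cancel hq0.ne', one_pow]
  -- the linear rescaling `diag(q^m, 1, …, 1)`
  set d : Fin (m + 1) → ℚ := fun i => if i = 0 then (q : ℚ) ^ m else 1 with hd
  have hdR : ∀ i, (d i : ℝ) = if i = 0 then (q : ℝ) ^ m else 1 := fun i => by
    simp only [hd]
    split_ifs <;> simp
  have hd0 : ∀ i, (d i : ℝ) ≠ 0 := fun i => by
    rw [hdR]
    split_ifs
    · exact pow_ne_zero m hq0.ne'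
    · norm_num
  set L : (Fin (m + 1) → ℝ) →L[ℝ] (Fin (m + 1) → ℝ) :=
    LinearMap.toContinuousLinearMap (Matrix.toLin' (Matrix.diagonal fun i => (d i : ℝ))) with hL
  have hLapply : ∀ x i, L x i = (d i : ℝ) * x i := fun x i => by
    rw [hL, LinearMap.coe_toContinuousLinearMap', Matrix.toLin'_apply, Matrix.mulVec_diagonal]
  have hLdet : L.det = (q : ℝ) ^ m := by
    rw [ContinuousLinearMap.det, hL]
    simp only [LinearMap.coe_toContinuousLinearMap]  -- coercion back to the linear map
    rw [LinearMap.det_toLin', Matrix.det_diagonal]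
    simp_rw [hdR]
    rw [Finset.prod_ite_eq']
    simp
  have hLsa : IsSemialgebraicMapOn ℚ R.domain L := by
    refine (isSemialgebraicMapOn_aeval hT fun j => MvPolynomial.C (d j) * X j).congr fun x _ => ?_
    funext j
    rw [hLapply]
    simp
  have hLinj : InjOn L R.domain := by
    intro x _ y _ hxy
    funext i
    have := congr_fun hxy i
    rw [hLapply, hLapply] at this
    exact mul_left_cancel₀ (hd0 i) this
  have hBsa : IsSemialgebraic ℚ (L '' R.domain) :=
    IsSemialgebraicMapOn.isSemialgebraic_image_holds hLsa subset_rfl hT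
  have hBb : Bornology.IsBounded (L '' R.domain) := L.lipschitz.isBounded_image hTb
  have hB1 : IsSemialgebraicFunOn ℚ (L '' R.domain) fun _ => (1 : ℝ) := by
    simpa using isSemialgebraicFunOn_ratCast hBsa 1
  let B : IntegralRep (m + 1) := ⟨L '' R.domain, fun _ => 1, hBsa, hB1,
    integrableOn_const hBb.measure_lt_top.ne⟩
  have e2 : of R - of B ∈ changeOfVariablesRel :=
    of_sub_of_mem_changeOfVariablesRel_linear R B L hLsa hLinj rfl fun x _ => by
      show (q : ℝ) ^ m = 1 * |L.det|
      rw [hLdet, one_mul, abs_of_pos (by positivity)]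
  refine ⟨B, hBb, fun _ _ => rfl, ?_⟩
  have : of D - of B = (of D - of R) + (of R - of B) := by abel
  rw [this]
  exact relations.add_mem (changeOfVariablesRel_subset_relations e1)
    (changeOfVariablesRel_subset_relations e2)

end KZ

end Literature.NumberTheory.Transcendental
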